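import Literature.MathematicalPhysics.KineticTheory.HardSphereMarginalTrace
import Literature.MathematicalPhysics.KineticTheory.TaggedSphereOneStepInputs
import Literature.MathematicalPhysics.KineticTheory.HardSphereBBGKYLiouvillePrelim
import Literature.MathematicalPhysics.KineticTheory.TaggedSphereLinearBoltzmannAeInputs
import HarnessLib

/-!
# The contact-trace form (H1♯) of the one-step hierarchy from its generic form (H1)
(Bodineau–Gallagher–Saint-Raymond, Invent. Math. 203 (2016), arXiv:1305.3397v2, §3.1 Remark 3.1
p. 9 and (4.3) p. 11; Cercignani–Illner–Pulvirenti 1994 §4.3 (3.4) "continuity along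
trajectories"; trunk T-KINETIC, topic MathematicalPhysics/KineticTheory.)

`TaggedSphereOneStepInputs.bgsr_linearBoltzmannApprox_of_oneStep` reduces BGSR's Theorem 2.2
(2.9) to the one-step integrated BBGKY hierarchy for the honest marginals `f_N^{(k)}` in two
forms: (H1) the identity for Lebesgue-a.e. configuration, and (H1♯) the same identity AT the
outgoing contact configurations `outRep(gainConfig / lossConfig)` read by the collision
operator, for a.e. collision parameter. This file PROVES (H1♯) from (H1): the marginal read
along the backward tagged flow from an outgoing contact configuration `W♯`,
`u ↦ f^{(k+1)}(τ - u, Φ_{-u} W♯)`, satisfies (H1) for a.e. `u` (pull-back along the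
quasi-measure-preserving transported adjunction, `gainPullback` / `lossPullback`), its distance
to `f^{(k+1)}(τ, W♯)` is `O(u)` (the short-time decoupling estimate
`abs_marginal_backward_sub_le` of `HardSphereMarginalTrace`, whose good-fibre hypothesis holds
for a.e. `u` by the same pull-back), and the right-hand side of (H1) is Lipschitz in the time;
letting `u → 0⁺` along the full-measure set gives the identity at `W♯` itself.

* §1 casts `Fin.cast` commute with the regularised flow, the good set and the energy;
* §2 the marginal `f_N^{(s)}` as the tagged marginal of a `transportedDatum` on
  `Config (s + m)`, `m = N + 1 - s` (`bgsrMarginalFamily_eq_integral_transportedDatum`);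
* §3 the real-variable trace lemma `eq_of_ae_approx`;
* §4 the Duhamel integrand along a backward orbit is bounded (`abs_collisionRead_le`);
* §5 the good-fibre property holds for a.e. tagged configuration;
* §6 `bgsr_contactTrace_gain/loss`, `bgsr_oneStep_sharp_of_oneStep` — (H1♯) from (H1), in the
  exact shape of the hypothesis `hH` of `bgsr_linearBoltzmannApprox_of_oneStep`; and the
  corollary `bgsr_linearBoltzmannApprox_of_H1 : (H1) → bgsr_linearBoltzmannApprox`;
* §7 the same reduction for the iterated Duhamel formula (S) (`bgsr_seriesFamily_ae_eq_of_H1`)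
  and for fact (c) `bodineau_gallagher_saintRaymond_linear` (`…_of_H1`, through
  `bodineau_gallagher_saintRaymond_linear_of_S` of `TaggedSphereLinearBoltzmannAeInputs`): both
  named forms of BGSR's Theorem 2.2 in the tree now follow from (H1) alone.

## References

* T. Bodineau, I. Gallagher, L. Saint-Raymond, Invent. Math. 203 (2016) 493–553,
  arXiv:1305.3397v2, §3.1, §4.
* C. Cercignani, R. Illner, M. Pulvirenti, *The Mathematical Theory of Dilute Gases* (1994),
  §4.3, App. 4.B.
-/

open MeasureTheory MeasureTheory.Measure Metric Real Set Filter Function Topology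
open scoped InnerProductSpace ENNReal
open Literature.Analysis.FluidPDE

namespace Literature.MathematicalPhysics.KineticTheory

noncomputable section

set_option synthInstance.maxSize 1024

variable {d : Type*} [Fintype d]

/-! ## §1. Casts -/

section Casts

variable {ε : ℝ} {n n' : ℕ}

/-- The regularised flow commutes with re-indexing along an equality of particle numbers.
[folklore] -/
theorem regFlow_comp_cast (h : n = n') (t : ℝ) (z : Config n' d (UnitAddTorus d)) :
    Alexander.regFlow (N := n) (Torus.geometry d) ε t (fun i => z (Fin.cast h i)) =
      fun i => Alexander.regFlow (N := n') (Torus.geometry d) ε t z (Fin.cast h i) := by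
  subst h; rfl

/-- The good set is invariant under re-indexing along an equality of particle numbers.
[folklore] -/
theorem comp_cast_mem_good_iff (h : n = n') (z : Config n' d (UnitAddTorus d)) :
    (fun i => z (Fin.cast h i) : Config n d (UnitAddTorus d)) ∈ Alexander.good (N := n) (Torus.geometry d) ε ↔
      z ∈ Alexander.good (N := n') (Torus.geometry d) ε := by
  subst h; exact Iff.rfl

omit [Fintype d] in
/-- The energy is invariant under re-indexing along an equality of particle numbers.
[folklore] -/
theorem configEnergy_comp_cast [Fintype d] {X : Type*} (h : n = n') (z : Config n' d X) :
    configEnergy (fun i => z (Fin.cast h i) : Config n d X) = configEnergy z := by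
  subst h; rfl

omit [Fintype d] in
/-- Re-indexing along an equality of particle numbers is measurable. [folklore] -/
theorem measurable_comp_cast {X : Type*} [MeasurableSpace X] (h : n = n') :
    Measurable fun z : Config n' d X => (fun i => z (Fin.cast h i) : Config n d X) := by
  subst h; exact measurable_id

end Casts

/-! ## §2. The marginals as tagged marginals of a transported datum -/

section Bridge

variable {ε : ℝ} (hε : 0 < ε) (hε' : ε < 2⁻¹) (N : ℕ) (β : ℝ) (ρ₀ : UnitAddTorus d → ℝ)

/-- The level-`s` marginal `f_N^{(s)}(t)`, `s ≤ N + 1`, is the tagged marginal of the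
transported datum `F₀ = f_N^{(N+1)}(0)` re-indexed to `Config (s + (N + 1 - s))`
(`nthMarginal_of_le`, `nthMarginal_self_apply`, and the casts of §1). [folklore] -/
theorem bgsrMarginalFamily_eq_integral_transportedDatum {s : ℕ} (hs : s ≤ N + 1) (t : ℝ)
    (W : Config s d (UnitAddTorus d)) :
    bgsrMarginalFamily hε hε' N β ρ₀ s t W =
      ∫ Zm : Config (N + 1 - s) d (UnitAddTorus d),
        transportedDatum (ε := ε) (s := s) (m := N + 1 - s)
          (fun z => bgsrMarginalFamily hε hε' N β ρ₀ (N + 1) 0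
            (fun i => z (Fin.cast (Nat.add_sub_of_le hs).symm i)))
          t (Fin.append W Zm) := by
  haveI : SigmaFinite (volume : Measure (UnitAddTorus d × EuclideanSpace ℝ d)) := inferInstance
  rw [bgsrMarginalFamily_apply, nthMarginal_of_le hs]
  simp only [marginal]
  refine integral_congr_ae (Eventually.of_forall fun Zm => ?_)
  set z : Config (s + (N + 1 - s)) d (UnitAddTorus d) := Fin.append W Zm with hz
  have htop : ∀ z' : Config (N + 1) d (UnitAddTorus d), bgsrMarginalFamily hε hε' N β ρ₀ (N + 1) 0 z' =
      (Alexander.regHardSphereFlow (d := d) hε hε' (N + 1)).good.indicator (bgsrInitialDensity ε N β ρ₀) z' := by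
    intro z'
    rw [bgsrMarginalFamily_apply, nthMarginal_self_apply]
    by_cases hz' : z' ∈ (Alexander.regHardSphereFlow (d := d) hε hε' (N + 1)).good
    · rw [indicator_of_mem hz', indicator_of_mem hz']
      show bgsrInitialDensity ε N β ρ₀ (Alexander.regFlow (Torus.geometry d) ε (-0) z') = _
      rw [neg_zero, Alexander.regFlow_zero hε hε']
    · rw [indicator_of_notMem hz', indicator_of_notMem hz']
  simp only [transportedDatum, htop]
  have hgood : ∀ y : Config (s + (N + 1 - s)) d (UnitAddTorus d),
      (fun i => y (Fin.cast (Nat.add_sub_of_le hs).symm i) : Config (N + 1) d (UnitAddTorus d)) ∈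
          (Alexander.regHardSphereFlow (d := d) hε hε' (N + 1)).good ↔
        y ∈ Alexander.good (N := s + (N + 1 - s)) (Torus.geometry d) ε :=
    fun y => comp_cast_mem_good_iff (ε := ε) (Nat.add_sub_of_le hs).symm y
  by_cases hzg : z ∈ Alexander.good (N := s + (N + 1 - s)) (Torus.geometry d) ε
  · have h1 : (fun i => z (Fin.cast (Nat.add_sub_of_le hs).symm i) : Config (N + 1) d (UnitAddTorus d)) ∈
        (Alexander.regHardSphereFlow (d := d) hε hε' (N + 1)).good := (hgood z).2 hzg
    have h2 : (fun i => Alexander.regFlow (Torus.geometry d) ε (-t) z (Fin.cast (Nat.add_sub_of_le hs).symm i) :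
        Config (N + 1) d (UnitAddTorus d)) ∈ (Alexander.regHardSphereFlow (d := d) hε hε' (N + 1)).good :=
      (hgood _).2 (Alexander.mapsTo_regFlow_good hε hε' (-t) hzg)
    rw [indicator_of_mem h1, indicator_of_mem hzg, indicator_of_mem h2]
    show bgsrInitialDensity ε N β ρ₀ (Alexander.regFlow (Torus.geometry d) ε (-t) _) = _
    rw [regFlow_comp_cast]
  · have h1 : (fun i => z (Fin.cast (Nat.add_sub_of_le hs).symm i) : Config (N + 1) d (UnitAddTorus d)) ∉
        (Alexander.regHardSphereFlow (d := d) hε hε' (N + 1)).good := fun h => hzg ((hgood z).1 h)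
    rw [indicator_of_notMem h1, indicator_of_notMem hzg]

/-- The re-indexed top marginal at time `0` is a measurable datum with the Gaussian bound of
BGSR Prop. 4.1 (`abs_bgsrMarginalFamily_le`). [cite: BodineauGallagherSaintRaymondInvent2016, Prop. 4.1 p. 11] -/
theorem bgsrTopDatum_bound (hβ : 0 < β) {R : ℝ} (hρ₀0 : ∀ x, 0 ≤ ρ₀ x) (hR : ∀ x, ρ₀ x ≤ R)
    (hN : (N : ℝ) * (2 * ε) ^ Fintype.card d ≤ 2⁻¹) {s : ℕ} (hs : s ≤ N + 1)
    (z : Config (s + (N + 1 - s)) d (UnitAddTorus d)) :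
    |bgsrMarginalFamily hε hε' N β ρ₀ (N + 1) 0 (fun i => z (Fin.cast (Nat.add_sub_of_le hs).symm i))| ≤
      R * (max 1 (2 * maxwellianConst d β)) ^ (N + 1) * Real.exp (-β * configEnergy z) := by
  have h := abs_bgsrMarginalFamily_le hε hε' N β ρ₀ hβ hρ₀0 hR hN (N + 1) 0
    (fun i => z (Fin.cast (Nat.add_sub_of_le hs).symm i))
  rwa [configEnergy_comp_cast] at h

/-- The re-indexed top marginal at time `0` is measurable. [folklore] -/
theorem measurable_bgsrTopDatum (hρ₀m : Measurable ρ₀) {s : ℕ} (hs : s ≤ N + 1) :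
    Measurable fun z : Config (s + (N + 1 - s)) d (UnitAddTorus d) =>
      bgsrMarginalFamily hε hε' N β ρ₀ (N + 1) 0 (fun i => z (Fin.cast (Nat.add_sub_of_le hs).symm i)) :=
  (measurable_bgsrMarginalFamily hε hε' N β ρ₀ hρ₀m (N + 1) 0).comp (measurable_comp_cast _)

end Bridge

/-! ## §3. The real-variable trace lemma -/

section RealTrace

/-- **Trace from an a.e. identity, an `O(τ - t)` modulus and a Lipschitz right-hand side.** If
`φ(t) = c + P(t)` for a.e. `t ∈ (0, τ)`, `|φ(t) - a| ≤ C (τ - t)` for a.e. `t ∈ (0, τ)` and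
`|P(t) - P(τ)| ≤ L (τ - t)` on `(0, τ)`, `τ > 0`, then `a = c + P(τ)` (the exceptional sets
are null, so there are admissible `t` arbitrarily close to `τ`). [folklore] -/
theorem eq_of_ae_approx {φ P : ℝ → ℝ} {a c C L τ : ℝ} (hτ : 0 < τ)
    (h1 : ∀ᵐ t : ℝ, t ∈ Ioo 0 τ → φ t = c + P t)
    (h2 : ∀ᵐ t : ℝ, t ∈ Ioo 0 τ → |φ t - a| ≤ C * (τ - t))
    (h3 : ∀ t ∈ Ioo 0 τ, |P t - P τ| ≤ L * (τ - t)) :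
    a = c + P τ := by
  by_contra hne
  have hη : 0 < |a - (c + P τ)| := abs_pos.2 (sub_ne_zero.2 hne)
  set η : ℝ := |a - (c + P τ)| with hηdef
  have hCL : 0 < |C| + |L| + 1 := by positivity
  set δ : ℝ := min τ (η / (2 * (|C| + |L| + 1))) with hδ
  have hδpos : 0 < δ := lt_min hτ (by positivity)
  have hδτ : δ ≤ τ := min_le_left _ _
  -- an admissible `t ∈ (τ - δ, τ)`
  have hex : ∃ t ∈ Ioo (τ - δ) τ, φ t = c + P t ∧ |φ t - a| ≤ C * (τ - t) := by
    by_contra hno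
    push Not at hno
    have hsub : ∀ᵐ t : ℝ, t ∉ Ioo (τ - δ) τ := by
      filter_upwards [h1, h2] with t ht1 ht2 ht
      have ht' : t ∈ Ioo 0 τ := ⟨by linarith [ht.1], ht.2⟩
      exact absurd (ht2 ht') (not_le.2 (hno t ht (ht1 ht')))
    have h0 : volume (Ioo (τ - δ) τ) = 0 := measure_eq_zero_iff_ae_notMem.2 hsub
    rw [Real.volume_Ioo] at h0
    have : ENNReal.ofReal (τ - (τ - δ)) ≠ 0 := by
      rw [sub_sub_cancel]; exact (ENNReal.ofReal_pos.2 hδpos).ne'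
    exact this h0
  obtain ⟨t, ht, hφ, hmod⟩ := hex
  have ht' : t ∈ Ioo 0 τ := ⟨by linarith [ht.1], ht.2⟩
  have hP := h3 t ht'
  have hτt : 0 ≤ τ - t := by linarith [ht.2]
  have hτt' : τ - t < δ := by linarith [ht.1]
  -- `η ≤ (|C| + |L|)(τ - t) < η / 2`
  have hkey : η ≤ (|C| + |L|) * (τ - t) := by
    have e1 : |a - (c + P τ)| ≤ |a - φ t| + |φ t - (c + P τ)| := abs_sub_le _ _ _
    have e2 : |a - φ t| ≤ |C| * (τ - t) := by
      rw [abs_sub_comm]; exact hmod.trans (mul_le_mul_of_nonneg_right (le_abs_self C) hτt)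
    have e3 : |φ t - (c + P τ)| ≤ |L| * (τ - t) := by
      rw [hφ, show c + P t - (c + P τ) = P t - P τ by ring]
      exact hP.trans (mul_le_mul_of_nonneg_right (le_abs_self L) hτt)
    calc η = |a - (c + P τ)| := rfl
      _ ≤ |C| * (τ - t) + |L| * (τ - t) := e1.trans (add_le_add e2 e3)
      _ = (|C| + |L|) * (τ - t) := by ring
  have hlt : (|C| + |L|) * (τ - t) < η / 2 := by
    have h1' : (|C| + |L|) * (τ - t) ≤ (|C| + |L| + 1) * (τ - t) :=
      mul_le_mul_of_nonneg_right (by linarith) hτt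
    have h2' : (|C| + |L| + 1) * (τ - t) < (|C| + |L| + 1) * δ := mul_lt_mul_of_pos_left hτt' hCL
    have h3' : (|C| + |L| + 1) * δ ≤ (|C| + |L| + 1) * (η / (2 * (|C| + |L| + 1))) :=
      mul_le_mul_of_nonneg_left (min_le_right _ _) hCL.le
    have h4' : (|C| + |L| + 1) * (η / (2 * (|C| + |L| + 1))) = η / 2 := by
      field_simp
    linarith
  linarith

end RealTrace

/-! ## §4. The Duhamel integrand along a backward orbit is bounded -/

section DuhamelRead

variable {ε : ℝ} (hε : 0 < ε) (hε' : ε < 2⁻¹) (N : ℕ) (β : ℝ) (ρ₀ : UnitAddTorus d → ℝ)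

/-- **The read of the collision term along the backward tagged orbit is bounded**:
`τ' ↦ (C_{S,S+1} f_N^{(S+1)}(τ'))(Φ^S_{-(τ-τ')} W)` is measurable and bounded by a constant
depending on `W` only (the weighted single-step estimate `op_weighted` (4.11) with the uniform
Gaussian bound of the marginals, Prop. 4.1, energy conservation and `‖v_i‖ ≤ √(2E)`).
[cite: BodineauGallagherSaintRaymondInvent2016, §4.3 (4.11) p. 12] -/
theorem abs_collisionRead_le (hβ : 0 < β) (hρ₀m : Measurable ρ₀) {R : ℝ} (hρ₀0 : ∀ x, 0 ≤ ρ₀ x)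
    (hR : ∀ x, ρ₀ x ≤ R) (hN : (N : ℝ) * (2 * ε) ^ Fintype.card d ≤ 2⁻¹) (S : ℕ) (τ : ℝ)
    (W : Config S d (UnitAddTorus d)) :
    ∃ L : ℝ, 0 ≤ L ∧
      (Measurable fun τ' : ℝ => (hsHierarchyModel (d := d) hε hε' (N + 1)).op S
          (bgsrMarginalFamily hε hε' N β ρ₀ (S + 1) τ')
          (Alexander.regFlow (Torus.geometry d) ε (-(τ - τ')) W)) ∧
      ∀ τ' : ℝ, |(hsHierarchyModel (d := d) hε hε' (N + 1)).op S (bgsrMarginalFamily hε hε' N β ρ₀ (S + 1) τ')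
          (Alexander.regFlow (Torus.geometry d) ε (-(τ - τ')) W)| ≤ L := by
  set M := hsHierarchyModel (d := d) hε hε' (N + 1) with hM
  set K₀ : ℝ := R * (max 1 (2 * maxwellianConst d β)) ^ (S + 1) with hK₀
  have hR0 : 0 ≤ R := (hρ₀0 0).trans (hR 0)
  have hK₀0 : 0 ≤ K₀ := by rw [hK₀]; positivity
  have hg : ∀ τ' Z, |bgsrMarginalFamily hε hε' N β ρ₀ (S + 1) τ' Z| ≤ K₀ * Real.exp (-β * configEnergy Z) :=
    fun τ' Z => abs_bgsrMarginalFamily_le hε hε' N β ρ₀ hβ hρ₀0 hR hN (S + 1) τ' Z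
  set V : ℝ := Real.sqrt (2 * configEnergy W) with hV
  set L : ℝ := M.opConst * (Real.sqrt β ^ Fintype.card d)⁻¹ * (S * (Real.sqrt β)⁻¹ + S * V) *
    (K₀ * Real.exp (-β * configEnergy W)) with hL
  have hL0 : 0 ≤ L := by
    rw [hL]
    have h1 : 0 ≤ M.opConst := M.opConst_nonneg
    positivity
  refine ⟨L, hL0, ?_, fun τ' => ?_⟩
  · -- measurability
    have hu := measurable_bgsrMarginalFamily_uncurry hε hε' N β ρ₀ hρ₀m (S + 1)
    have hop := M.measurable_op S hu
    have hcurve : Measurable fun τ' : ℝ => (τ', Alexander.regFlow (Torus.geometry d) ε (-(τ - τ')) W) := by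
      refine measurable_id.prodMk ?_
      have h2 : Measurable fun τ' : ℝ => ((-(τ - τ'), W) : ℝ × Config S d (UnitAddTorus d)) :=
        ((measurable_const.sub measurable_id).neg).prodMk measurable_const
      have h := (Alexander.measurable_regFlow_uncurry (d := d) (N := S) (ε := ε) hε').comp h2
      exact h
    have h3 : Measurable ((fun p : ℝ × Config S d (UnitAddTorus d) =>
        M.op S (fun Z => bgsrMarginalFamily hε hε' N β ρ₀ (S + 1) p.1 Z) p.2) ∘
        (fun τ' : ℝ => (τ', Alexander.regFlow (Torus.geometry d) ε (-(τ - τ')) W))) := hop.comp hcurve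
    simpa only [Function.comp_def] using h3
  · have hw := M.op_weighted S (bgsrMarginalFamily hε hε' N β ρ₀ (S + 1) τ') K₀ β hβ hK₀0 (hg τ')
      (Alexander.regFlow (Torus.geometry d) ε (-(τ - τ')) W)
    rw [Alexander.configEnergy_regFlow] at hw
    refine hw.trans ?_
    rw [hL]
    have hsum : ∑ i, ‖(Alexander.regFlow (Torus.geometry d) ε (-(τ - τ')) W i).2‖ ≤ S * V := by
      have h1 : ∀ i, ‖(Alexander.regFlow (Torus.geometry d) ε (-(τ - τ')) W i).2‖ ≤ V := by
        intro i
        have h := norm_vel_le_sqrt_configEnergy (Alexander.regFlow (Torus.geometry d) ε (-(τ - τ')) W) i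
        rwa [Alexander.configEnergy_regFlow] at h
      calc ∑ i, ‖(Alexander.regFlow (Torus.geometry d) ε (-(τ - τ')) W i).2‖ ≤ ∑ _i : Fin S, V :=
            Finset.sum_le_sum fun i _ => h1 i
        _ = S * V := by rw [Finset.sum_const, Finset.card_univ, Fintype.card_fin, nsmul_eq_mul]
    have h1 : 0 ≤ M.opConst := M.opConst_nonneg
    have h2 : 0 ≤ M.opConst * (Real.sqrt β ^ Fintype.card d)⁻¹ := by positivity
    have h3 : 0 ≤ K₀ * Real.exp (-β * configEnergy W) := by positivity
    gcongr

end DuhamelRead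

/-! ## §5. The good-fibre property holds for a.e. tagged configuration -/

section Fibre

variable {ε : ℝ} (hε : 0 < ε) (hε' : ε < 2⁻¹) (s m : ℕ)

include hε hε' in
/-- **Almost every tagged configuration has a good fibre**: for a.e. `w ∈ Config s`, for a.e.
untagged `Z`, the juxtaposition `(w, Z)` is good for the regularised `(s+m)`-flow whenever it
lies in the hard-sphere domain (the complement of the good set is Liouville-null, Alexander 1975;
the juxtaposition is measure-preserving, `exists_appendEquiv`; Fubini). [folklore] -/
theorem ae_ae_append_mem_good :
    ∀ᵐ w : Config s d (UnitAddTorus d), ∀ᵐ Zm : Config m d (UnitAddTorus d),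
      Fin.append w Zm ∈ hardSphereDomain (Torus.geometry d) (s + m) ε →
      Fin.append w Zm ∈ Alexander.good (N := s + m) (Torus.geometry d) ε := by
  haveI : SigmaFinite (volume : Measure (UnitAddTorus d × EuclideanSpace ℝ d)) := inferInstance
  obtain ⟨e, he, hmp⟩ := exists_appendEquiv s m (UnitAddTorus d × EuclideanSpace ℝ d)
  set Φn := Alexander.regHardSphereFlow (d := d) hε hε' (s + m) with hΦn
  have hnull : volume (hardSphereDomain (Torus.geometry d) (s + m) ε ∩ (Alexander.good (N := s + m) (Torus.geometry d) ε)ᶜ) = 0 := by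
    have h := Φn.measure_compl_good
    rw [liouville_eq, Measure.restrict_apply Φn.measurableSet_good.compl, Set.inter_comm] at h
    exact h
  have hEm : MeasurableSet (hardSphereDomain (Torus.geometry d) (s + m) ε ∩ (Alexander.good (N := s + m) (Torus.geometry d) ε)ᶜ) :=
    (measurableSet_hardSphereDomain (Torus.geometry d) Torus.measurable_geometry_sepVec (s + m) ε).inter Φn.measurableSet_good.compl
  have hpre : (volume : Measure ((Config s d (UnitAddTorus d)) × (Config m d (UnitAddTorus d))))
      (e ⁻¹' (hardSphereDomain (Torus.geometry d) (s + m) ε ∩ (Alexander.good (N := s + m) (Torus.geometry d) ε)ᶜ)) = 0 := by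
    rw [← hmp.measure_preimage hEm.nullMeasurableSet] at hnull
    exact hnull
  have hae : ∀ᵐ p : (Config s d (UnitAddTorus d)) × (Config m d (UnitAddTorus d)),
      p ∉ e ⁻¹' (hardSphereDomain (Torus.geometry d) (s + m) ε ∩ (Alexander.good (N := s + m) (Torus.geometry d) ε)ᶜ) :=
    measure_eq_zero_iff_ae_notMem.1 hpre
  have hae' : ∀ᵐ p : (Config s d (UnitAddTorus d)) × (Config m d (UnitAddTorus d)) ∂((volume).prod volume),
      Fin.append p.1 p.2 ∈ hardSphereDomain (Torus.geometry d) (s + m) ε →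
      Fin.append p.1 p.2 ∈ Alexander.good (N := s + m) (Torus.geometry d) ε := by
    have h : (volume : Measure ((Config s d (UnitAddTorus d)) × (Config m d (UnitAddTorus d)))) = (volume).prod volume := rfl
    rw [← h]
    filter_upwards [hae] with p hp hD
    by_contra hg
    apply hp
    rw [Set.mem_preimage, he p]
    exact ⟨hD, hg⟩
  exact Measure.ae_ae_of_ae_prod hae'

end Fibre

/-! ## §6. The contact-trace identity -/

section Core

variable {ε : ℝ} (hε : 0 < ε) (hε' : ε < 2⁻¹) (N : ℕ) (β : ℝ) (ρ₀ : UnitAddTorus d → ℝ)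

include hε hε' in
/-- **The core of (H1♯) from (H1).** Fix the level `k + 1 ≤ N + 1`, a measurable family of
tagged configurations `W♯(Z', q) ∈ Config (k+1)` indexed by the collision parameters, a
measurable parameter condition `cond`, and assume: the transported family
`((u, Z'), q) ↦ Φ_{-u} W♯(Z', q)` is quasi-measure-preserving on `{u > 0} ∩ cond` (the
pull-back property `gainPullback` / `lossPullback`), `W♯` is good for a.e. admissible
parameter, and the one-step hierarchy (H1) holds at level `k + 1` for a.e. configuration at
every time `t ≥ 0`. Then the one-step hierarchy holds AT `W♯(Z', q)` at time `τ`, for a.e.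
`((τ, Z'), q)` with `τ > 0` and `cond` — by `eq_of_ae_approx` with the pulled-back (H1)
(`ae_transfer_along_pullback`), the short-time decoupling estimate
`abs_marginal_backward_sub_le` (good fibres a.e. along the pull-back, `ae_ae_append_mem_good`)
and the Lipschitz bound of the collision integral (`abs_collisionRead_le`).
[cite: BodineauGallagherSaintRaymondInvent2016, §3.1 Remark 3.1 p. 9] -/
theorem contactTrace_core (hβ : 0 < β) (hρ₀m : Measurable ρ₀) {R : ℝ} (hρ₀0 : ∀ x, 0 ≤ ρ₀ x)
    (hR : ∀ x, ρ₀ x ≤ R) (hN : (N : ℝ) * (2 * ε) ^ Fintype.card d ≤ 2⁻¹) {k : ℕ} (hS : k + 1 ≤ N + 1)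
    {cond : Config k d (UnitAddTorus d) × (sphere (0 : EuclideanSpace ℝ d) 1 × EuclideanSpace ℝ d) → Prop}
    (hcondm : MeasurableSet {x | cond x})
    {Wsh : Config k d (UnitAddTorus d) × (sphere (0 : EuclideanSpace ℝ d) 1 × EuclideanSpace ℝ d) →
      Config (k + 1) d (UnitAddTorus d)} (hWm : Measurable Wsh)
    (hΛ : QuasiMeasurePreserving
      (fun p : (ℝ × Config k d (UnitAddTorus d)) × (sphere (0 : EuclideanSpace ℝ d) 1 × EuclideanSpace ℝ d) =>
        Alexander.regFlow (Torus.geometry d) ε (-p.1.1) (Wsh (p.1.2, p.2)))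
      ((((volume : Measure ℝ).prod (volume : Measure (Config k d (UnitAddTorus d)))).prod
        ((sphereMeasure (E := EuclideanSpace ℝ d)).prod (volume : Measure (EuclideanSpace ℝ d)))).restrict
        {p | 0 < p.1.1 ∧ cond (p.1.2, p.2)}) volume)
    (hgood : ∀ᵐ Z' : Config k d (UnitAddTorus d), ∀ᵐ q : sphere (0 : EuclideanSpace ℝ d) 1 × EuclideanSpace ℝ d
        ∂((sphereMeasure (E := EuclideanSpace ℝ d)).prod volume), cond (Z', q) →
        Wsh (Z', q) ∈ Alexander.good (N := k + 1) (Torus.geometry d) ε)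
    (hH1 : ∀ t : ℝ, 0 ≤ t → ∀ᵐ Z : Config (k + 1) d (UnitAddTorus d),
      bgsrMarginalFamily hε hε' N β ρ₀ (k + 1) t Z =
        (hsHierarchyModel (d := d) hε hε' (N + 1)).transport (k + 1) t (bgsrMarginalFamily hε hε' N β ρ₀ (k + 1) 0) Z +
          ∫ τ' in (0 : ℝ)..t, (hsHierarchyModel (d := d) hε hε' (N + 1)).transport (k + 1) (t - τ')
            ((hsHierarchyModel (d := d) hε hε' (N + 1)).op (k + 1) (bgsrMarginalFamily hε hε' N β ρ₀ (k + 1 + 1) τ')) Z) :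
    ∀ᵐ p : (ℝ × Config k d (UnitAddTorus d)) × (sphere (0 : EuclideanSpace ℝ d) 1 × EuclideanSpace ℝ d)
        ∂(((volume : Measure ℝ).prod (volume : Measure (Config k d (UnitAddTorus d)))).prod
          ((sphereMeasure (E := EuclideanSpace ℝ d)).prod (volume : Measure (EuclideanSpace ℝ d)))),
      0 < p.1.1 → cond (p.1.2, p.2) →
        bgsrMarginalFamily hε hε' N β ρ₀ (k + 1) p.1.1 (Wsh (p.1.2, p.2)) =
          (hsHierarchyModel (d := d) hε hε' (N + 1)).transport (k + 1) p.1.1 (bgsrMarginalFamily hε hε' N β ρ₀ (k + 1) 0)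
              (Wsh (p.1.2, p.2)) +
            ∫ τ' in (0 : ℝ)..p.1.1, (hsHierarchyModel (d := d) hε hε' (N + 1)).transport (k + 1) (p.1.1 - τ')
              ((hsHierarchyModel (d := d) hε hε' (N + 1)).op (k + 1) (bgsrMarginalFamily hε hε' N β ρ₀ (k + 1 + 1) τ'))
              (Wsh (p.1.2, p.2)) := by
  classical
  haveI : IsFiniteMeasure (sphereMeasure (E := EuclideanSpace ℝ d)) :=
    Literature.Analysis.FluidPDE.isFiniteMeasure_sphereMeasure
  haveI : SigmaFinite (volume : Measure (UnitAddTorus d × EuclideanSpace ℝ d)) := inferInstance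
  set M := hsHierarchyModel (d := d) hε hε' (N + 1) with hM
  set f := bgsrMarginalFamily hε hε' N β ρ₀ with hf
  set μQ : Measure (sphere (0 : EuclideanSpace ℝ d) 1 × EuclideanSpace ℝ d) :=
    (sphereMeasure (E := EuclideanSpace ℝ d)).prod volume with hμQ
  haveI : SFinite μQ := by rw [hμQ]; infer_instance
  -- the datum on `Config ((k+1) + (N+1-(k+1)))` and the decoupling constant
  set F₀ : Config (k + 1 + (N + 1 - (k + 1))) d (UnitAddTorus d) → ℝ := fun z =>
    f (N + 1) 0 (fun i => z (Fin.cast (Nat.add_sub_of_le hS).symm i)) with hF₀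
  set C₀ : ℝ := R * (max 1 (2 * maxwellianConst d β)) ^ (N + 1) with hC₀
  have hR0 : 0 ≤ R := (hρ₀0 0).trans (hR 0)
  have hC₀0 : 0 ≤ C₀ := by rw [hC₀]; positivity
  have hF₀m : Measurable F₀ := measurable_bgsrTopDatum hε hε' N β ρ₀ hρ₀m hS
  have hF₀b : ∀ z, |F₀ z| ≤ C₀ * Real.exp (-β * configEnergy z) := fun z =>
    bgsrTopDatum_bound hε hε' N β ρ₀ hβ hρ₀0 hR hN hS z
  obtain ⟨A, hA0, hTr⟩ := abs_marginal_backward_sub_le hε hε' (s := k + 1) (m := N + 1 - (k + 1)) F₀ hβ hC₀0 hF₀m hF₀b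
  have hbr : ∀ (t : ℝ) (W : Config (k + 1) d (UnitAddTorus d)), f (k + 1) t W =
      ∫ Zm : Config (N + 1 - (k + 1)) d (UnitAddTorus d), transportedDatum (ε := ε) F₀ t (Fin.append W Zm) :=
    fun t W => bgsrMarginalFamily_eq_integral_transportedDatum hε hε' N β ρ₀ hS t W
  have hfT : ∀ (k' : ℕ) (T : ℝ), IsNiceT T (f k') := fun k' T =>
    isNiceT_bgsrMarginalFamily hε hε' N β ρ₀ hβ hρ₀m hρ₀0 hR hN k' T
  -- the two sides of (H1) as functions of `(t, Z)`
  set K₁ : ℝ × Config (k + 1) d (UnitAddTorus d) → ℝ := fun y => f (k + 1) y.1 y.2 with hK₁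
  set K₂ : ℝ × Config (k + 1) d (UnitAddTorus d) → ℝ := fun y =>
    M.transport (k + 1) y.1 (f (k + 1) 0) y.2 + M.remainderTerm f 1 (k + 1) y.1 y.2 with hK₂
  have hK₁m : Measurable K₁ := measurable_bgsrMarginalFamily_uncurry hε hε' N β ρ₀ hρ₀m (k + 1)
  have hK₂m : Measurable K₂ := by
    have h1 : Measurable fun y : ℝ × Config (k + 1) d (UnitAddTorus d) =>
        f (k + 1) 0 (Alexander.regFlow (Torus.geometry d) ε (-y.1) y.2) := by
      have h2 : Measurable fun y : ℝ × Config (k + 1) d (UnitAddTorus d) => ((-y.1, y.2) : ℝ × Config (k + 1) d (UnitAddTorus d)) :=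
        measurable_fst.neg.prodMk measurable_snd
      have h := (Alexander.measurable_regFlow_uncurry (d := d) (N := k + 1) (ε := ε) hε').comp h2
      exact (measurable_bgsrMarginalFamily hε hε' N β ρ₀ hρ₀m (k + 1) 0).comp h
    exact h1.add (HierarchyModel.isNiceT_remainderTerm M hfT 1 (k + 1) 0).measurable
  -- (H1) as a product-a.e. statement
  have ih : ∀ᵐ y : ℝ × Config (k + 1) d (UnitAddTorus d) ∂((volume : Measure ℝ).prod volume), 0 < y.1 → K₁ y = K₂ y := by
    have hE : MeasurableSet {y : ℝ × Config (k + 1) d (UnitAddTorus d) | 0 < y.1 ∧ K₁ y ≠ K₂ y} :=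
      (measurableSet_lt measurable_const measurable_fst).inter (measurableSet_eq_fun hK₁m hK₂m).compl
    have h0 : ((volume : Measure ℝ).prod (volume : Measure (Config (k + 1) d (UnitAddTorus d))))
        {y | 0 < y.1 ∧ K₁ y ≠ K₂ y} = 0 := by
      rw [Measure.measure_prod_null hE]
      refine Eventually.of_forall fun t => ?_
      show volume (Prod.mk t ⁻¹' {y : ℝ × Config (k + 1) d (UnitAddTorus d) | 0 < y.1 ∧ K₁ y ≠ K₂ y}) = 0
      rcases le_or_gt t 0 with ht | ht
      · have : Prod.mk t ⁻¹' {y : ℝ × Config (k + 1) d (UnitAddTorus d) | 0 < y.1 ∧ K₁ y ≠ K₂ y} = ∅ := by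
          ext Z
          simp only [mem_preimage, mem_setOf_eq, mem_empty_iff_false, iff_false, not_and]
          intro h; linarith
        rw [this, measure_empty]
      · refine measure_mono_null (fun Z hZ => ?_) (ae_iff.1 (hH1 t ht.le))
        exact hZ.2
    filter_upwards [measure_eq_zero_iff_ae_notMem.1 h0] with y hy ht
    by_contra hne
    exact hy ⟨ht, hne⟩
  -- measurability of the parameter set
  have hSm : MeasurableSet {p : (ℝ × Config k d (UnitAddTorus d)) × (sphere (0 : EuclideanSpace ℝ d) 1 × EuclideanSpace ℝ d) |
      0 < p.1.1 ∧ cond (p.1.2, p.2)} :=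
    (measurableSet_lt measurable_const measurable_fst.fst).inter
      ((measurable_fst.snd.prodMk measurable_snd) hcondm)
  -- transfer of (H1)
  have hT1 := ae_transfer_along_pullback (K₁ := K₁) (K₂ := K₂) ih hSm hΛ
  -- transfer of the good-fibre property
  set KF : ℝ × Config (k + 1) d (UnitAddTorus d) → ℝ := fun y =>
    if (∀ᵐ Zm : Config (N + 1 - (k + 1)) d (UnitAddTorus d),
        Fin.append y.2 Zm ∈ hardSphereDomain (Torus.geometry d) (k + 1 + (N + 1 - (k + 1))) ε →
        Fin.append y.2 Zm ∈ Alexander.good (N := k + 1 + (N + 1 - (k + 1))) (Torus.geometry d) ε) then 0 else 1 with hKF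
  have ihF : ∀ᵐ y : ℝ × Config (k + 1) d (UnitAddTorus d) ∂((volume : Measure ℝ).prod volume),
      0 < y.1 → KF y = (fun _ => (0 : ℝ)) y := by
    have h := ae_ae_append_mem_good (d := d) hε hε' (k + 1) (N + 1 - (k + 1))
    have h2 : ∀ᵐ y : ℝ × Config (k + 1) d (UnitAddTorus d) ∂((volume : Measure ℝ).prod volume),
        ∀ᵐ Zm : Config (N + 1 - (k + 1)) d (UnitAddTorus d),
          Fin.append y.2 Zm ∈ hardSphereDomain (Torus.geometry d) (k + 1 + (N + 1 - (k + 1))) ε →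
          Fin.append y.2 Zm ∈ Alexander.good (N := k + 1 + (N + 1 - (k + 1))) (Torus.geometry d) ε :=
      (Measure.quasiMeasurePreserving_snd (μ := (volume : Measure ℝ))
        (ν := (volume : Measure (Config (k + 1) d (UnitAddTorus d))))).ae h
    filter_upwards [h2] with y hy _
    simp only [hKF, if_pos hy]
  have hT2 := ae_transfer_along_pullback (K₁ := KF) (K₂ := fun _ => (0 : ℝ)) ihF hSm hΛ
  -- goodness of `W♯`, lifted to the parameters
  have hT3 : ∀ᵐ y : ℝ × Config k d (UnitAddTorus d) ∂((volume : Measure ℝ).prod volume),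
      ∀ᵐ q : sphere (0 : EuclideanSpace ℝ d) 1 × EuclideanSpace ℝ d ∂μQ, cond (y.2, q) →
        Wsh (y.2, q) ∈ Alexander.good (N := k + 1) (Torus.geometry d) ε :=
    (Measure.quasiMeasurePreserving_snd (μ := (volume : Measure ℝ))
      (ν := (volume : Measure (Config k d (UnitAddTorus d))))).ae hgood
  -- the identity, parameter by parameter
  have hmain : ∀ᵐ y : ℝ × Config k d (UnitAddTorus d) ∂((volume : Measure ℝ).prod volume),
      ∀ᵐ q : sphere (0 : EuclideanSpace ℝ d) 1 × EuclideanSpace ℝ d ∂μQ, 0 < y.1 → cond (y.2, q) →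
        f (k + 1) y.1 (Wsh (y.2, q)) = M.transport (k + 1) y.1 (f (k + 1) 0) (Wsh (y.2, q)) +
          ∫ τ' in (0 : ℝ)..y.1, M.transport (k + 1) (y.1 - τ') (M.op (k + 1) (f (k + 1 + 1) τ')) (Wsh (y.2, q)) := by
    filter_upwards [hT1, hT2, hT3] with y h1 h2 h3
    filter_upwards [h1, h2, h3] with q h1q h2q h3q hτ hc
    set W := Wsh (y.2, q) with hW
    have hWg : W ∈ Alexander.good (N := k + 1) (Torus.geometry d) ε := h3q hc
    have hflow : ∀ a b : ℝ, Alexander.regFlow (Torus.geometry d) ε a (Alexander.regFlow (Torus.geometry d) ε b W) =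
        Alexander.regFlow (Torus.geometry d) ε (a + b) W := fun a b => (Alexander.regFlow_add hε hε' a b W).symm
    obtain ⟨L, hL0, hKm, hKb⟩ := abs_collisionRead_le hε hε' N β ρ₀ hβ hρ₀m hρ₀0 hR hN (k + 1) y.1 W
    -- the collision integral along the backward orbit and its Lipschitz bound
    set Kf : ℝ → ℝ := fun τ' => (M.op (k + 1) (f (k + 1 + 1) τ'))
      (Alexander.regFlow (Torus.geometry d) ε (-(y.1 - τ')) W) with hKf
    set P : ℝ → ℝ := fun t => ∫ τ' in (0 : ℝ)..t, Kf τ' with hP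
    have hKb' : ∀ τ', ‖Kf τ'‖ ≤ L := fun τ' => by rw [Real.norm_eq_abs]; exact hKb τ'
    have hKi : ∀ a b : ℝ, IntervalIntegrable Kf volume a b := fun a b =>
      (intervalIntegrable_const (c := L)).mono_fun' hKm.aestronglyMeasurable (Eventually.of_forall fun τ' => hKb' τ')
    have h3' : ∀ t ∈ Ioo 0 y.1, |P t - P y.1| ≤ L * (y.1 - t) := by
      intro t ht
      have hsub : P t - P y.1 = ∫ τ' in y.1..t, Kf τ' := by
        simp only [hP]
        exact intervalIntegral.integral_interval_sub_left (hKi 0 t) (hKi 0 y.1)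
      rw [hsub]
      have h := intervalIntegral.norm_integral_le_of_norm_le_const (a := y.1) (b := t) (C := L) (f := Kf)
        fun x _ => hKb' x
      rw [Real.norm_eq_abs, show |t - y.1| = y.1 - t by rw [abs_sub_comm]; exact abs_of_nonneg (by linarith [ht.2])] at h
      exact h
    -- (H1) along the backward orbit
    have h1' : ∀ᵐ t : ℝ, t ∈ Ioo 0 y.1 →
        f (k + 1) t (Alexander.regFlow (Torus.geometry d) ε (-(y.1 - t)) W) =
          f (k + 1) 0 (Alexander.regFlow (Torus.geometry d) ε (-y.1) W) + P t := by
      filter_upwards [h1q] with t h1t ht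
      have hmem : ((y.1 - t, y.2), q) ∈ {p : (ℝ × Config k d (UnitAddTorus d)) × (sphere (0 : EuclideanSpace ℝ d) 1 × EuclideanSpace ℝ d) |
          0 < p.1.1 ∧ cond (p.1.2, p.2)} := ⟨by show 0 < y.1 - t; linarith [ht.2], hc⟩
      have h := h1t hmem ht.1
      change f (k + 1) t (Alexander.regFlow (Torus.geometry d) ε (-(y.1 - t)) W) =
        M.transport (k + 1) t (f (k + 1) 0) (Alexander.regFlow (Torus.geometry d) ε (-(y.1 - t)) W) +
          M.remainderTerm f 1 (k + 1) t (Alexander.regFlow (Torus.geometry d) ε (-(y.1 - t)) W) at h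
      rw [h, HierarchyModel.remainderTerm_one]
      simp only [hM, hsHierarchyModel_transport_apply]
      rw [hflow, show -t + -(y.1 - t) = -y.1 by ring]
      congr 1
      refine intervalIntegral.integral_congr fun τ' _ => ?_
      simp only [hKf, hM, hflow]
      congr 2
      ring
    -- the modulus from the decoupling estimate
    have h2' : ∀ᵐ t : ℝ, t ∈ Ioo 0 y.1 →
        |f (k + 1) t (Alexander.regFlow (Torus.geometry d) ε (-(y.1 - t)) W) - f (k + 1) y.1 W| ≤
          (2 * C₀ * A * Real.exp (-(β / 2) * configEnergy W)) * (y.1 - t) := by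
      filter_upwards [h2q] with t h2t ht
      have hmem : ((y.1 - t, y.2), q) ∈ {p : (ℝ × Config k d (UnitAddTorus d)) × (sphere (0 : EuclideanSpace ℝ d) 1 × EuclideanSpace ℝ d) |
          0 < p.1.1 ∧ cond (p.1.2, p.2)} := ⟨by show 0 < y.1 - t; linarith [ht.2], hc⟩
      have hF := h2t hmem ht.1
      have hfib : ∀ᵐ Zm : Config (N + 1 - (k + 1)) d (UnitAddTorus d),
          Fin.append (Alexander.regFlow (Torus.geometry d) ε (-(y.1 - t)) W) Zm ∈
              hardSphereDomain (Torus.geometry d) (k + 1 + (N + 1 - (k + 1))) ε →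
            Fin.append (Alexander.regFlow (Torus.geometry d) ε (-(y.1 - t)) W) Zm ∈
              Alexander.good (N := k + 1 + (N + 1 - (k + 1))) (Torus.geometry d) ε := by
        by_contra hno
        have h1 : KF (t, Alexander.regFlow (Torus.geometry d) ε (-(y.1 - t)) W) = 1 := by
          simp only [hKF]
          rw [if_neg hno]
        have h2 : KF (t, Alexander.regFlow (Torus.geometry d) ε (-(y.1 - t)) W) = 0 := hF
        rw [h1] at h2
        exact one_ne_zero h2
      have hT := hTr y.1 (u := y.1 - t) (by linarith [ht.2]) hWg hfib
      rw [show y.1 - (y.1 - t) = t by ring, ← hbr, ← hbr] at hT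
      calc |f (k + 1) t (Alexander.regFlow (Torus.geometry d) ε (-(y.1 - t)) W) - f (k + 1) y.1 W|
          ≤ 2 * C₀ * A * (y.1 - t) * Real.exp (-(β / 2) * configEnergy W) := hT
        _ = (2 * C₀ * A * Real.exp (-(β / 2) * configEnergy W)) * (y.1 - t) := by ring
    have hfinal := eq_of_ae_approx (φ := fun t => f (k + 1) t (Alexander.regFlow (Torus.geometry d) ε (-(y.1 - t)) W))
      (P := P) (a := f (k + 1) y.1 W) (c := f (k + 1) 0 (Alexander.regFlow (Torus.geometry d) ε (-y.1) W)) hτ h1' h2' h3'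
    rw [hfinal]
    simp only [hP, hKf, hM, hsHierarchyModel_transport_apply]
  -- back to the product measure
  have hL : Measurable fun p : (ℝ × Config k d (UnitAddTorus d)) × (sphere (0 : EuclideanSpace ℝ d) 1 × EuclideanSpace ℝ d) =>
      K₁ (p.1.1, Wsh (p.1.2, p.2)) :=
    hK₁m.comp (measurable_fst.fst.prodMk (hWm.comp (measurable_fst.snd.prodMk measurable_snd)))
  have hRm : Measurable fun p : (ℝ × Config k d (UnitAddTorus d)) × (sphere (0 : EuclideanSpace ℝ d) 1 × EuclideanSpace ℝ d) =>
      K₂ (p.1.1, Wsh (p.1.2, p.2)) :=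
    hK₂m.comp (measurable_fst.fst.prodMk (hWm.comp (measurable_fst.snd.prodMk measurable_snd)))
  have hset : MeasurableSet {p : (ℝ × Config k d (UnitAddTorus d)) × (sphere (0 : EuclideanSpace ℝ d) 1 × EuclideanSpace ℝ d) |
      0 < p.1.1 → cond (p.1.2, p.2) →
        f (k + 1) p.1.1 (Wsh (p.1.2, p.2)) = M.transport (k + 1) p.1.1 (f (k + 1) 0) (Wsh (p.1.2, p.2)) +
          ∫ τ' in (0 : ℝ)..p.1.1, M.transport (k + 1) (p.1.1 - τ') (M.op (k + 1) (f (k + 1 + 1) τ')) (Wsh (p.1.2, p.2))} := by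
    have heq : {p : (ℝ × Config k d (UnitAddTorus d)) × (sphere (0 : EuclideanSpace ℝ d) 1 × EuclideanSpace ℝ d) |
        0 < p.1.1 → cond (p.1.2, p.2) →
          f (k + 1) p.1.1 (Wsh (p.1.2, p.2)) = M.transport (k + 1) p.1.1 (f (k + 1) 0) (Wsh (p.1.2, p.2)) +
            ∫ τ' in (0 : ℝ)..p.1.1, M.transport (k + 1) (p.1.1 - τ') (M.op (k + 1) (f (k + 1 + 1) τ')) (Wsh (p.1.2, p.2))} =
        {p | 0 < p.1.1 ∧ cond (p.1.2, p.2)}ᶜ ∪ {p | K₁ (p.1.1, Wsh (p.1.2, p.2)) = K₂ (p.1.1, Wsh (p.1.2, p.2))} := by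
      ext p
      simp only [mem_setOf_eq, mem_union, mem_compl_iff, not_and, hK₁, hK₂, HierarchyModel.remainderTerm_one]
      tauto
    rw [heq]
    exact hSm.compl.union (measurableSet_eq_fun hL hRm)
  exact (Measure.ae_prod_iff_ae_ae hset).2 hmain

end Core

/-! ## §7. (H1♯) from (H1), and BGSR's theorem from (H1) alone -/

section Sharp

variable {ε : ℝ} (hε : 0 < ε) (hε' : ε < 2⁻¹) (N : ℕ) (β : ℝ) (ρ₀ : UnitAddTorus d → ℝ)

/-- The gain parameter condition is measurable. [folklore] -/
theorem measurableSet_gainCond {k : ℕ} (i : Fin k) :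
    MeasurableSet {x : Config k d (UnitAddTorus d) × (sphere (0 : EuclideanSpace ℝ d) 1 × EuclideanSpace ℝ d) |
      0 < ⟪(x.2.1 : EuclideanSpace ℝ d), x.2.2 - (x.1 i).2⟫_ℝ ∧
        gainConfig (Torus.geometry d) ε x.1 i x.2.1 x.2.2 ∈ hardSphereDomain (Torus.geometry d) (k + 1) ε} := by
  have hin : Measurable fun x : Config k d (UnitAddTorus d) × (sphere (0 : EuclideanSpace ℝ d) 1 × EuclideanSpace ℝ d) =>
      ⟪(x.2.1 : EuclideanSpace ℝ d), x.2.2 - (x.1 i).2⟫_ℝ :=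
    (continuous_subtype_val.measurable.comp measurable_snd.fst).inner
      (measurable_snd.snd.sub ((measurable_pi_apply i).comp measurable_fst).snd)
  have hg : Measurable fun x : Config k d (UnitAddTorus d) × (sphere (0 : EuclideanSpace ℝ d) 1 × EuclideanSpace ℝ d) =>
      gainConfig (Torus.geometry d) ε x.1 i x.2.1 x.2.2 :=
    Literature.Analysis.FluidPDE.measurable_gainConfig measurable_translate_torus ε i measurable_fst
      (continuous_subtype_val.measurable.comp measurable_snd.fst) measurable_snd.snd
  exact (measurableSet_lt measurable_const hin).inter (hg (measurableSet_hardSphereDomain_torus (k + 1) ε))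

/-- The loss parameter condition is measurable. [folklore] -/
theorem measurableSet_lossCond {k : ℕ} (i : Fin k) :
    MeasurableSet {x : Config k d (UnitAddTorus d) × (sphere (0 : EuclideanSpace ℝ d) 1 × EuclideanSpace ℝ d) |
      ⟪(x.2.1 : EuclideanSpace ℝ d), x.2.2 - (x.1 i).2⟫_ℝ < 0 ∧
        lossConfig (Torus.geometry d) ε x.1 i x.2.1 x.2.2 ∈ hardSphereDomain (Torus.geometry d) (k + 1) ε} := by
  have hin : Measurable fun x : Config k d (UnitAddTorus d) × (sphere (0 : EuclideanSpace ℝ d) 1 × EuclideanSpace ℝ d) =>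
      ⟪(x.2.1 : EuclideanSpace ℝ d), x.2.2 - (x.1 i).2⟫_ℝ :=
    (continuous_subtype_val.measurable.comp measurable_snd.fst).inner
      (measurable_snd.snd.sub ((measurable_pi_apply i).comp measurable_fst).snd)
  have hg : Measurable fun x : Config k d (UnitAddTorus d) × (sphere (0 : EuclideanSpace ℝ d) 1 × EuclideanSpace ℝ d) =>
      lossConfig (Torus.geometry d) ε x.1 i x.2.1 x.2.2 :=
    Literature.Analysis.FluidPDE.measurable_lossConfig measurable_translate_torus ε i measurable_fst
      (continuous_subtype_val.measurable.comp measurable_snd.fst) measurable_snd.snd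
  exact (measurableSet_lt hin measurable_const).inter (hg (measurableSet_hardSphereDomain_torus (k + 1) ε))

/-- The outgoing representative of the gain configuration is a measurable function of the
parameters. [folklore] -/
theorem measurable_outRep_gainConfig {k : ℕ} (i : Fin k) :
    Measurable fun x : Config k d (UnitAddTorus d) × (sphere (0 : EuclideanSpace ℝ d) 1 × EuclideanSpace ℝ d) =>
      outRep (Torus.geometry d) k i (gainConfig (Torus.geometry d) ε x.1 i x.2.1 x.2.2) := by
  have hg : Measurable fun x : Config k d (UnitAddTorus d) × (sphere (0 : EuclideanSpace ℝ d) 1 × EuclideanSpace ℝ d) =>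
      gainConfig (Torus.geometry d) ε x.1 i x.2.1 x.2.2 :=
    Literature.Analysis.FluidPDE.measurable_gainConfig measurable_translate_torus ε i measurable_fst
      (continuous_subtype_val.measurable.comp measurable_snd.fst) measurable_snd.snd
  exact (measurable_outRep (Literature.Analysis.FluidPDE.Torus.isMeasurable_geometry (d := d)) k i).comp hg

/-- The outgoing representative of the loss configuration is a measurable function of the
parameters. [folklore] -/
theorem measurable_outRep_lossConfig {k : ℕ} (i : Fin k) :
    Measurable fun x : Config k d (UnitAddTorus d) × (sphere (0 : EuclideanSpace ℝ d) 1 × EuclideanSpace ℝ d) =>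
      outRep (Torus.geometry d) k i (lossConfig (Torus.geometry d) ε x.1 i x.2.1 x.2.2) := by
  have hg : Measurable fun x : Config k d (UnitAddTorus d) × (sphere (0 : EuclideanSpace ℝ d) 1 × EuclideanSpace ℝ d) =>
      lossConfig (Torus.geometry d) ε x.1 i x.2.1 x.2.2 :=
    Literature.Analysis.FluidPDE.measurable_lossConfig measurable_translate_torus ε i measurable_fst
      (continuous_subtype_val.measurable.comp measurable_snd.fst) measurable_snd.snd
  exact (measurable_outRep (Literature.Analysis.FluidPDE.Torus.isMeasurable_geometry (d := d)) k i).comp hg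

include hε hε' in
/-- **(H1♯) from (H1)** for BGSR's marginals (`d ≥ 2`, `0 < ε < 1/2`, `N(2ε)^d ≤ 1/2`, `β > 0`,
measurable `0 ≤ ρ⁰ ≤ R`): if the one-step integrated hierarchy holds for a.e. configuration at
every `t ≥ 0` and every level, then it holds at the outgoing contact configurations
`outRep(gainConfig)` / `outRep(lossConfig)` read by the collision operator, for a.e. collision
parameter — the hypothesis `hH` of `bgsr_linearBoltzmannApprox_of_oneStep`
(`contactTrace_core` with `gainPullback` / `lossPullback` and the flux-a.e. goodness
`ae_regularityClause`; levels above `N + 1` vanish). [cite: BodineauGallagherSaintRaymondInvent2016, §3.1 Remark 3.1 p. 9; (4.3) p. 11] -/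
theorem bgsr_oneStep_sharp_of_oneStep (hd : 2 ≤ Fintype.card d) (hβ : 0 < β) (hρ₀m : Measurable ρ₀) {R : ℝ}
    (hρ₀0 : ∀ x, 0 ≤ ρ₀ x) (hR : ∀ x, ρ₀ x ≤ R) (hN : (N : ℝ) * (2 * ε) ^ Fintype.card d ≤ 2⁻¹)
    (hH1 : ∀ (k : ℕ) (t : ℝ), 0 ≤ t → ∀ᵐ Z : Config k d (UnitAddTorus d),
      bgsrMarginalFamily hε hε' N β ρ₀ k t Z =
        (hsHierarchyModel (d := d) hε hε' (N + 1)).transport k t (bgsrMarginalFamily hε hε' N β ρ₀ k 0) Z +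
          ∫ τ in (0 : ℝ)..t, (hsHierarchyModel (d := d) hε hε' (N + 1)).transport k (t - τ)
            ((hsHierarchyModel (d := d) hε hε' (N + 1)).op k (bgsrMarginalFamily hε hε' N β ρ₀ (k + 1) τ)) Z)
    (k : ℕ) (i : Fin k) :
    ∀ᵐ p : (ℝ × Config k d (UnitAddTorus d)) × (sphere (0 : EuclideanSpace ℝ d) 1 × EuclideanSpace ℝ d)
        ∂(((volume : Measure ℝ).prod (volume : Measure (Config k d (UnitAddTorus d)))).prod
          ((sphereMeasure (E := EuclideanSpace ℝ d)).prod (volume : Measure (EuclideanSpace ℝ d)))),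
      (0 < p.1.1 → 0 < ⟪(p.2.1 : EuclideanSpace ℝ d), p.2.2 - (p.1.2 i).2⟫_ℝ →
        gainConfig (Literature.Analysis.FluidPDE.Torus.geometry d) ε p.1.2 i p.2.1 p.2.2 ∈ hardSphereDomain (Literature.Analysis.FluidPDE.Torus.geometry d) (k + 1) ε →
        (bgsrMarginalFamily hε hε' N β ρ₀) (k + 1) p.1.1 (outRep (Literature.Analysis.FluidPDE.Torus.geometry d) k i (gainConfig (Literature.Analysis.FluidPDE.Torus.geometry d) ε p.1.2 i p.2.1 p.2.2)) =
          (hsHierarchyModel (d := d) hε hε' (N + 1)).transport (k + 1) p.1.1 ((bgsrMarginalFamily hε hε' N β ρ₀) (k + 1) 0)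
              (outRep (Literature.Analysis.FluidPDE.Torus.geometry d) k i (gainConfig (Literature.Analysis.FluidPDE.Torus.geometry d) ε p.1.2 i p.2.1 p.2.2)) +
            ∫ τ' in (0 : ℝ)..p.1.1, (hsHierarchyModel (d := d) hε hε' (N + 1)).transport (k + 1) (p.1.1 - τ')
              ((hsHierarchyModel (d := d) hε hε' (N + 1)).op (k + 1) ((bgsrMarginalFamily hε hε' N β ρ₀) (k + 1 + 1) τ'))
              (outRep (Literature.Analysis.FluidPDE.Torus.geometry d) k i (gainConfig (Literature.Analysis.FluidPDE.Torus.geometry d) ε p.1.2 i p.2.1 p.2.2))) ∧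
      (0 < p.1.1 → ⟪(p.2.1 : EuclideanSpace ℝ d), p.2.2 - (p.1.2 i).2⟫_ℝ < 0 →
        lossConfig (Literature.Analysis.FluidPDE.Torus.geometry d) ε p.1.2 i p.2.1 p.2.2 ∈ hardSphereDomain (Literature.Analysis.FluidPDE.Torus.geometry d) (k + 1) ε →
        (bgsrMarginalFamily hε hε' N β ρ₀) (k + 1) p.1.1 (outRep (Literature.Analysis.FluidPDE.Torus.geometry d) k i (lossConfig (Literature.Analysis.FluidPDE.Torus.geometry d) ε p.1.2 i p.2.1 p.2.2)) =
          (hsHierarchyModel (d := d) hε hε' (N + 1)).transport (k + 1) p.1.1 ((bgsrMarginalFamily hε hε' N β ρ₀) (k + 1) 0)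
              (outRep (Literature.Analysis.FluidPDE.Torus.geometry d) k i (lossConfig (Literature.Analysis.FluidPDE.Torus.geometry d) ε p.1.2 i p.2.1 p.2.2)) +
            ∫ τ' in (0 : ℝ)..p.1.1, (hsHierarchyModel (d := d) hε hε' (N + 1)).transport (k + 1) (p.1.1 - τ')
              ((hsHierarchyModel (d := d) hε hε' (N + 1)).op (k + 1) ((bgsrMarginalFamily hε hε' N β ρ₀) (k + 1 + 1) τ'))
              (outRep (Literature.Analysis.FluidPDE.Torus.geometry d) k i (lossConfig (Literature.Analysis.FluidPDE.Torus.geometry d) ε p.1.2 i p.2.1 p.2.2))) := by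
  haveI : IsFiniteMeasure (sphereMeasure (E := EuclideanSpace ℝ d)) :=
    Literature.Analysis.FluidPDE.isFiniteMeasure_sphereMeasure
  -- levels above `N + 1`: everything vanishes
  rcases le_or_gt (k + 1) (N + 1) with hS | hS
  swap
  · have h0 : ∀ t, bgsrMarginalFamily hε hε' N β ρ₀ (k + 1) t = 0 := bgsrMarginalFamily_eq_zero_of_lt hε hε' N β ρ₀ hS
    have h1 : ∀ t, bgsrMarginalFamily hε hε' N β ρ₀ (k + 1 + 1) t = 0 :=
      bgsrMarginalFamily_eq_zero_of_lt hε hε' N β ρ₀ (by omega)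
    refine Eventually.of_forall fun p => ⟨fun _ _ _ => ?_, fun _ _ _ => ?_⟩ <;>
    · simp only [h0, h1, Pi.zero_apply, HierarchyModel.op_zero, hsHierarchyModel_transport_apply,
        intervalIntegral.integral_zero, add_zero]
  -- the level `k + 1 ≤ N + 1`: `k = m + 1`
  cases k with
  | zero => exact i.elim0
  | succ m =>
    have hIH : ∀ (k' : ℕ) (h : ℝ), ∀ᵐ W : Config k' d (UnitAddTorus d), bgsrRegular ε 0 k' h W :=
      fun k' h => Eventually.of_forall fun W => trivial
    have hreg := ae_regularityClause hε hε' hd hIH i 0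
    have hG := contactTrace_core hε hε' N β ρ₀ hβ hρ₀m hρ₀0 hR hN hS
      (cond := fun x => 0 < ⟪(x.2.1 : EuclideanSpace ℝ d), x.2.2 - (x.1 i).2⟫_ℝ ∧
        gainConfig (Torus.geometry d) ε x.1 i x.2.1 x.2.2 ∈ hardSphereDomain (Torus.geometry d) (m + 1 + 1) ε)
      (measurableSet_gainCond (ε := ε) i)
      (Wsh := fun x => outRep (Torus.geometry d) (m + 1) i (gainConfig (Torus.geometry d) ε x.1 i x.2.1 x.2.2))
      (measurable_outRep_gainConfig (ε := ε) i) (gainPullback hε hε' hd (m + 1) i)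
      (hreg.mono fun Z' h => h.mono fun q hq hc => (hq.1 hc.1 hc.2).1) (hH1 (m + 1 + 1))
    have hL := contactTrace_core hε hε' N β ρ₀ hβ hρ₀m hρ₀0 hR hN hS
      (cond := fun x => ⟪(x.2.1 : EuclideanSpace ℝ d), x.2.2 - (x.1 i).2⟫_ℝ < 0 ∧
        lossConfig (Torus.geometry d) ε x.1 i x.2.1 x.2.2 ∈ hardSphereDomain (Torus.geometry d) (m + 1 + 1) ε)
      (measurableSet_lossCond (ε := ε) i)
      (Wsh := fun x => outRep (Torus.geometry d) (m + 1) i (lossConfig (Torus.geometry d) ε x.1 i x.2.1 x.2.2))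
      (measurable_outRep_lossConfig (ε := ε) i) (lossPullback hε hε' hd (m + 1) i)
      (hreg.mono fun Z' h => h.mono fun q hq hc => (hq.2 hc.1 hc.2).1) (hH1 (m + 1 + 1))
    filter_upwards [hG, hL] with p hGp hLp
    exact ⟨fun hτ hb hD => hGp hτ ⟨hb, hD⟩, fun hτ hb hD => hLp hτ ⟨hb, hD⟩⟩

/-- **BGSR's Theorem 2.2 (2.9) from the one-step integrated BBGKY hierarchy alone.** If, for
`d ≥ 2`, the regime `0 < ε < 1/2`, `N(2ε)^d ≤ 1/2`, `β > 0` and continuous probability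
densities `0 ≤ ρ⁰ ≤ R`, the honest marginals `f_N^{(k)}(t)` of the transported datum
`M_{N,β} ρ⁰(x₁)` satisfy the one-step integrated hierarchy
`f^{(k)}(t) = S_k(t) f^{(k)}(0) + ∫_0^t S_k(t-τ) C_{k,k+1} f^{(k+1)}(τ) dτ` for a.e.
configuration, at every `t ≥ 0` and every level `k` (BGSR (4.3); CIP Thm 4.3.1), then
`bgsr_linearBoltzmannApprox` holds: the contact-trace form (H1♯) is
`bgsr_oneStep_sharp_of_oneStep`, and `bgsr_linearBoltzmannApprox_of_oneStep` concludes.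
[cite: BodineauGallagherSaintRaymondInvent2016, Thm 2.2 (2.9) p. 7; (4.3) p. 11] -/
theorem bgsr_linearBoltzmannApprox_of_H1 [DecidableEq d]
    (hH1 : 2 ≤ Fintype.card d → ∀ (N : ℕ) (ε : ℝ) (hε : 0 < ε) (hε' : ε < 2⁻¹),
      (N : ℝ) * (2 * ε) ^ Fintype.card d ≤ 2⁻¹ →
      ∀ (β : ℝ), 0 < β → ∀ (R : ℝ) (ρ₀ : UnitAddTorus d → ℝ), Continuous ρ₀ → (∀ x, 0 ≤ ρ₀ x) →
      (∀ x, ρ₀ x ≤ R) → ∫ x, ρ₀ x = 1 →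
        ∀ (k : ℕ) (t : ℝ), 0 ≤ t → ∀ᵐ Z : Config k d (UnitAddTorus d),
          bgsrMarginalFamily hε hε' N β ρ₀ k t Z =
            (hsHierarchyModel (d := d) hε hε' (N + 1)).transport k t (bgsrMarginalFamily hε hε' N β ρ₀ k 0) Z +
              ∫ τ in (0 : ℝ)..t, (hsHierarchyModel (d := d) hε hε' (N + 1)).transport k (t - τ)
                ((hsHierarchyModel (d := d) hε hε' (N + 1)).op k (bgsrMarginalFamily hε hε' N β ρ₀ (k + 1) τ)) Z) :
    bgsr_linearBoltzmannApprox (d := d) :=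
  bgsr_linearBoltzmannApprox_of_oneStep hH1 fun hd N ε hε hε' hN β hβ R ρ₀ hc h0 hR _ k i =>
    bgsr_oneStep_sharp_of_oneStep hε hε' N β ρ₀ hd hβ hc.measurable h0 hR hN (hH1 hd N ε hε hε' hN β hβ R ρ₀ hc h0 hR ‹_›) k i

/-! ## §7. (S) and fact (c) from (H1) alone -/

/-- **The iterated Duhamel formula up to null sets ((S)) for BGSR's marginals from the one-step
hierarchy (H1) alone** (`d ≥ 2`, `0 < ε < 1/2`, `N(2ε)^d ≤ 1/2`, `β > 0`, measurable
`0 ≤ ρ⁰ ≤ R`): `bgsr_seriesFamily_ae_eq_of_oneStep` with (H1♯) supplied by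
`bgsr_oneStep_sharp_of_oneStep`. [cite: BodineauGallagherSaintRaymondInvent2016, §3.1 Remark 3.1 p. 9; (4.3) p. 11] -/
theorem bgsr_seriesFamily_ae_eq_of_H1 (hd : 2 ≤ Fintype.card d) (hβ : 0 < β) (hρ₀m : Measurable ρ₀) {R : ℝ}
    (hρ₀0 : ∀ x, 0 ≤ ρ₀ x) (hR : ∀ x, ρ₀ x ≤ R) (hN : (N : ℝ) * (2 * ε) ^ Fintype.card d ≤ 2⁻¹)
    (hH1 : ∀ (k : ℕ) (t : ℝ), 0 ≤ t → ∀ᵐ Z : Config k d (UnitAddTorus d),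
      bgsrMarginalFamily hε hε' N β ρ₀ k t Z =
        (hsHierarchyModel (d := d) hε hε' (N + 1)).transport k t (bgsrMarginalFamily hε hε' N β ρ₀ k 0) Z +
          ∫ τ in (0 : ℝ)..t, (hsHierarchyModel (d := d) hε hε' (N + 1)).transport k (t - τ)
            ((hsHierarchyModel (d := d) hε hε' (N + 1)).op k (bgsrMarginalFamily hε hε' N β ρ₀ (k + 1) τ)) Z)
    (s : ℕ) {t : ℝ} (ht : 0 ≤ t) :
    (hsHierarchyModel (d := d) hε hε' (N + 1)).seriesFamily (N + 1)
        (fun k => bgsrMarginalFamily hε hε' N β ρ₀ k 0) s t =ᵐ[volume]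
      bgsrMarginalFamily hε hε' N β ρ₀ s t :=
  bgsr_seriesFamily_ae_eq_of_oneStep hε hε' N β ρ₀ hd hβ hρ₀m hρ₀0 hR hN hH1
    (bgsr_oneStep_sharp_of_oneStep hε hε' N β ρ₀ hd hβ hρ₀m hρ₀0 hR hN hH1) s ht

end Sharp

/-- **Fact (c) `bodineau_gallagher_saintRaymond_linear` (BGSR Thm 2.2 at `α = 1`) from the
one-step integrated BBGKY hierarchy (H1) alone**: `bodineau_gallagher_saintRaymond_linear_of_S`
(`TaggedSphereLinearBoltzmannAeInputs`) with (S) from `bgsr_seriesFamily_ae_eq_of_H1`, the bound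
`R` of the continuous density `ρ⁰` being its maximum on the compact torus. Together with
`bgsr_linearBoltzmannApprox_of_H1`, both named forms of BGSR's Theorem 2.2 in the tree are thus
reduced to (H1) (CIP 1994 Thm 4.3.1 / Spohn 2006 Prop. 5 for the honest marginals).
[cite: BodineauGallagherSaintRaymondInvent2016, Thm 2.2 p. 7; (4.3) p. 11] -/
theorem bodineau_gallagher_saintRaymond_linear_of_H1 [DecidableEq d]
    (hH1 : 2 ≤ Fintype.card d → ∀ (N : ℕ) (ε : ℝ) (hε : 0 < ε) (hε' : ε < 2⁻¹),
      (N : ℝ) * (2 * ε) ^ Fintype.card d ≤ 2⁻¹ →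
      ∀ (β : ℝ), 0 < β → ∀ (R : ℝ) (ρ₀ : UnitAddTorus d → ℝ), Continuous ρ₀ → (∀ x, 0 ≤ ρ₀ x) →
      (∀ x, ρ₀ x ≤ R) → ∫ x, ρ₀ x = 1 →
        ∀ (k : ℕ) (t : ℝ), 0 ≤ t → ∀ᵐ Z : Config k d (UnitAddTorus d),
          bgsrMarginalFamily hε hε' N β ρ₀ k t Z =
            (hsHierarchyModel (d := d) hε hε' (N + 1)).transport k t (bgsrMarginalFamily hε hε' N β ρ₀ k 0) Z +
              ∫ τ in (0 : ℝ)..t, (hsHierarchyModel (d := d) hε hε' (N + 1)).transport k (t - τ)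
                ((hsHierarchyModel (d := d) hε hε' (N + 1)).op k (bgsrMarginalFamily hε hε' N β ρ₀ (k + 1) τ)) Z) :
    bodineau_gallagher_saintRaymond_linear (d := d) :=
  bodineau_gallagher_saintRaymond_linear_of_S fun hd N ε hε hε' hN β hβ ρ₀ hc h0 h1 _ s _ t ht => by
    -- `ρ⁰` is bounded on the compact torus
    obtain ⟨x₀, -, hx₀⟩ := isCompact_univ.exists_isMaxOn univ_nonempty hc.continuousOn
    have hR : ∀ x, ρ₀ x ≤ ρ₀ x₀ := fun x => (isMaxOn_iff.1 hx₀) x (mem_univ x)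
    exact bgsr_seriesFamily_ae_eq_of_H1 hε hε' N β ρ₀ hd hβ hc.measurable h0 hR hN
      (hH1 hd N ε hε hε' hN β hβ (ρ₀ x₀) ρ₀ hc h0 hR h1) s ht.1

end

end Literature.MathematicalPhysics.KineticTheory
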